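import Literature.Geometry.Kaehler.RegularZeroLocus
import Literature.Analysis.Complex.SmoothHypersurfaceDivision
import HarnessLib

/-!
# Division by the next equation on a regular zero locus, and density of its non-zero set

Layer `Literature/Geometry/Kaehler`, companion of `RegularZeroLocus`. Let `Q'` be the prefix of
length `k'` of regular equations `Q` of length `k' + 1` on a complex manifold `M`, `Z' = Q'.locus`
the bigger zero locus (a complex manifold, `RegularEquations.atlas`) and
`u = (F_a)_{k'} : Z' ∩ O_a → ℂ` the last equation read on `Z'` (`IsPrefix.lastEq`), whose zero set
is `Z = Q.locus`. In the slice charts of `IsPrefix.exists_sliceChart_succ` the function `u` is a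
COORDINATE of `Z'`; consequently:

* `IsPrefix.mem_closure_lastEq_ne_zero` — every point of `Z' ∩ O_a` lies in the closure of
  `{u ≠ 0}` (so `{u ≠ 0}` is dense in every open subset over `O_a`: the injectivity input of
  "multiplication by `u`" on sections, Serre's `𝒪(L(m-1)) ↪ 𝒪(L(m))`);
* `IsPrefix.exists_eq_lastEq_mul` — **division**: a holomorphic function `g` on an open
  `W ⊆ Z' ∩ O_a` of the manifold `Z'` which vanishes on `Z ∩ W` is `u · q` for a (unique)
  holomorphic `q` on `W` — locally this is the tree's flat division theorem
  `Literature.Analysis.Complex.SCV.exists_eq_smul_of_eqOn_zero` (E. M. Chirka, *Complex Analytic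
  Sets* (1989), §2.8) transported through the slice chart, and the local quotients agree by density
  of `{u ≠ 0}`; this is the exactness in the middle of
  `0 → 𝒪_{Z'}(L) →ᵘ 𝒪_{Z'}(L(H)) → 𝒪_Z(L(H)) → 0` (J.-P. Serre, *FAC* (1955) n° 81; *GAGA* (1956)
  n° 16 Lemme 8) on the sections over `W`.

Everything is proved; the only definition is `IsPrefix.lastEq`.

## References

* E. M. Chirka, *Complex Analytic Sets*, Kluwer (1989), §2.8. [Chirka1989]
* J.-P. Serre, *Géométrie algébrique et géométrie analytique*, Ann. Inst. Fourier 6 (1956), n° 16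
  Lemme 8. [SerreGAGA1956]
* P. Griffiths, J. Harris, *Principles of Algebraic Geometry*, Wiley (1978), Ch. 0 §2 pp. 18–20.
  [GriffithsHarris1978]
-/

noncomputable section

open scoped Manifold ContDiff Topology
open Set Filter Function Module

namespace Literature.Geometry.Kaehler

namespace RegularEquations

namespace IsPrefix

variable {E : Type*} [NormedAddCommGroup E] [NormedSpace ℂ E] [FiniteDimensional ℂ E]
  {M : Type*} [TopologicalSpace M] [ChartedSpace E M] [IsManifold 𝓘(ℂ, E) ω M]
  {α : Type*} {k' d d' : ℕ} {Q' : RegularEquations E M α k'} {Q : RegularEquations E M α (k' + 1)}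
  (h : Q'.IsPrefix Q (Nat.le_succ k')) (hd : finrank ℂ E = (k' + 1) + d) (hd' : finrank ℂ E = k' + d')
  (a : α)

/-! ### The last equation read on the bigger locus -/

/-- **The last equation `u = (F_a)_{k'}` read on the manifold `Z' = Q'.locus`** (over `O_a`; junk
elsewhere). [cite: SerreGAGA1956, n° 16 Lemme 8] -/
def lastEq (_h : Q'.IsPrefix Q (Nat.le_succ k')) (hd' : finrank ℂ E = k' + d') (a : α) :
    (Q'.atlas hd').Carrier → ℂ := fun y ↦
  Q.F a ((Q'.atlas hd').val y) (Fin.last k')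

/-- `u` is holomorphic over `O_a`. [folklore] -/
theorem mdifferentiableOn_lastEq :
    MDifferentiableOn 𝓘(ℂ, Fin d' → ℂ) 𝓘(ℂ, ℂ) (h.lastEq hd' a) ((Q'.atlas hd').val ⁻¹' Q.O a) := by
  have h1 : MDifferentiableOn 𝓘(ℂ, E) 𝓘(ℂ, ℂ) (fun x ↦ Q.F a x (Fin.last k')) (Q.O a) :=
    (ContinuousLinearMap.proj (R := ℂ) (φ := fun _ : Fin (k' + 1) ↦ ℂ) (Fin.last k')).mdifferentiable
      |>.comp_mdifferentiableOn (Q.mdifferentiableOn_F a)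
  exact h1.comp (Q'.atlas hd').mdifferentiable_val.mdifferentiableOn fun _ hy ↦ hy

/-- `u` is continuous over `O_a`. [folklore] -/
theorem continuousOn_lastEq : ContinuousOn (h.lastEq hd' a) ((Q'.atlas hd').val ⁻¹' Q.O a) :=
  (h.mdifferentiableOn_lastEq hd' a).continuousOn

/-- Over `O_a` the preimage of `O_a` is open in `Z'`. [folklore] -/
theorem isOpen_preimage_O : IsOpen ((Q'.atlas hd').val ⁻¹' Q.O a) :=
  (Q.isOpen_O a).preimage (Q'.atlas hd').continuous_val

/-- **The zeros of `u` on `Z'` are the points of `Z`.** [folklore] -/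
theorem lastEq_eq_zero_iff {y : (Q'.atlas hd').Carrier} (hy : (Q'.atlas hd').val y ∈ Q.O a) :
    h.lastEq hd' a y = 0 ↔ (Q'.atlas hd').val y ∈ Q.locus := by
  have hy' : (Q'.atlas hd').val y ∈ Q'.O a := (h.O_eq a).symm ▸ hy
  have hQ' : Q'.F a ((Q'.atlas hd').val y) = 0 := (Q'.mem_locus_iff hy').1 ((Q'.atlas hd').val_mem y)
  rw [Q.mem_locus_iff hy]
  refine ⟨fun h0 ↦ funext fun i ↦ ?_, fun h0 ↦ ?_⟩
  · refine Fin.lastCases ?_ (fun j ↦ ?_) i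
    · exact h0
    · have := congrFun hQ' j
      rw [h.F_eq] at this
      exact this
  · exact congrFun h0 (Fin.last k')

include hd in
/-- **A chart of `Z'` in which `u` is the first coordinate**, around every zero of `u`
(`IsPrefix.exists_sliceChart_succ`). [cite: GriffithsHarris1978, Ch. 0 §2 pp. 18–20] -/
theorem exists_chart_lastEq {y : (Q'.atlas hd').Carrier} (hy : (Q'.atlas hd').val y ∈ Q.O a)
    (h0 : h.lastEq hd' a y = 0) :
    ∃ σ : AmbientHolChart E Q'.locus (ℂ × (Fin d → ℂ)), (Q'.atlas hd').toSubtype y ∈ σ.source ∧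
      (∀ y' ∈ σ.source, (y' : M) ∈ Q.O a) ∧
      ∀ y' ∈ σ.source, (σ.toOpenPartialHomeomorph y').1 = h.lastEq hd' a ((Q'.atlas hd').ofSubtype y') := by
  have hz : Q.F a ((Q'.atlas hd').val y) = 0 := (Q.mem_locus_iff hy).1 ((h.lastEq_eq_zero_iff hd' a hy).1 h0)
  obtain ⟨σ, hσ, hσa, hσ1⟩ := h.exists_sliceChart_succ hd hy hz
  exact ⟨σ, hσ, hσa, hσ1⟩

include hd in
/-- **Every point of `Z'` over `O_a` lies in the closure of `{u ≠ 0}`** (in the slice chart `u` is a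
coordinate, and `σ⁻¹(ε, w₀) → y` as `ε → 0`). [cite: GriffithsHarris1978, Ch. 0 §2 pp. 18–20] -/
theorem mem_closure_lastEq_ne_zero {y : (Q'.atlas hd').Carrier} (hy : (Q'.atlas hd').val y ∈ Q.O a) :
    y ∈ closure {y' | h.lastEq hd' a y' ≠ 0} := by
  by_cases h0 : h.lastEq hd' a y = 0
  swap
  · exact subset_closure h0
  obtain ⟨σ, hyσ, -, hσ1⟩ := h.exists_chart_lastEq hd hd' a hy h0
  rw [mem_closure_iff_nhds]
  intro V hV
  -- `σ⁻¹` is continuous at `σ y`, so `σ⁻¹(w) ∈ V` for `w` near `σ y`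
  set w₀ : ℂ × (Fin d → ℂ) := σ.toOpenPartialHomeomorph ((Q'.atlas hd').toSubtype y) with hw₀
  have hw₀t : w₀ ∈ σ.target := σ.map_source hyσ
  have hcont : ContinuousAt (fun w ↦ (Q'.atlas hd').ofSubtype (σ.toOpenPartialHomeomorph.symm w)) w₀ :=
    ((Q'.atlas hd').continuous_ofSubtype.continuousAt).comp (σ.toOpenPartialHomeomorph.continuousAt_symm hw₀t)
  have hy_eq : (Q'.atlas hd').ofSubtype (σ.toOpenPartialHomeomorph.symm w₀) = y := by
    rw [hw₀, σ.left_inv hyσ]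
    rfl
  have hV' : (fun w ↦ (Q'.atlas hd').ofSubtype (σ.toOpenPartialHomeomorph.symm w)) ⁻¹' V ∈ 𝓝 w₀ := by
    refine hcont.preimage_mem_nhds ?_
    rw [hy_eq]
    exact hV
  have hT : σ.target ∈ 𝓝 w₀ := σ.open_target.mem_nhds hw₀t
  obtain ⟨ε, hε, hball⟩ := Metric.mem_nhds_iff.1 (inter_mem hV' hT)
  -- the point `w₁ = w₀ + (ε/2, 0)` has non-zero first coordinate `ε/2` (as `w₀.1 = u y = 0`)
  have hw₀1 : w₀.1 = 0 := by
    rw [hw₀, hσ1 _ hyσ]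
    exact h0
  set w₁ : ℂ × (Fin d → ℂ) := (((ε / 2 : ℝ) : ℂ), w₀.2) with hw₁
  have hw₁ball : w₁ ∈ Metric.ball w₀ ε := by
    rw [Metric.mem_ball, Prod.dist_eq, hw₁, hw₀1]
    simp only [dist_self, dist_zero_right, Complex.norm_real, Real.norm_eq_abs]
    rw [max_eq_left (abs_nonneg _), abs_of_pos (half_pos hε)]
    exact half_lt_self hε
  obtain ⟨hw₁V, hw₁t⟩ := hball hw₁ball
  refine ⟨(Q'.atlas hd').ofSubtype (σ.toOpenPartialHomeomorph.symm w₁), hw₁V, ?_⟩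
  change h.lastEq hd' a ((Q'.atlas hd').ofSubtype (σ.toOpenPartialHomeomorph.symm w₁)) ≠ 0
  rw [← hσ1 _ (σ.map_target hw₁t), σ.right_inv hw₁t, hw₁]
  simp only [ne_eq, Complex.ofReal_eq_zero]
  exact (half_pos hε).ne'

/-- **Uniqueness of quotients at a point of the closure of `{u ≠ 0}`**: if `u q₁ = u q₂` near `y`
with `q₁, q₂` continuous at `y`, then `q₁ y = q₂ y`. [folklore] -/
theorem eq_of_lastEq_mul_eq {y : (Q'.atlas hd').Carrier} (hcl : y ∈ closure {y' | h.lastEq hd' a y' ≠ 0})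
    {V : Set (Q'.atlas hd').Carrier} (hV : V ∈ 𝓝 y) {q₁ q₂ : (Q'.atlas hd').Carrier → ℂ}
    (h1 : ContinuousAt q₁ y) (h2 : ContinuousAt q₂ y)
    (heq : ∀ y' ∈ V, h.lastEq hd' a y' * q₁ y' = h.lastEq hd' a y' * q₂ y') : q₁ y = q₂ y := by
  by_contra hne
  have hev : ∀ᶠ y' in 𝓝 y, q₁ y' - q₂ y' ≠ 0 := (h1.sub h2).eventually_ne (sub_ne_zero.2 hne)
  rw [mem_closure_iff_nhds] at hcl
  obtain ⟨y', ⟨hy'V, hy'ne⟩, hy'u⟩ := hcl _ (inter_mem hV hev)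
  exact hy'ne (sub_eq_zero.2 (mul_left_cancel₀ hy'u (heq y' hy'V)))

include hd in
/-- **Local division near a zero of `u`** (flat division in the slice chart). [cite: Chirka1989, §2.8] -/
theorem exists_local_quotient_of_eq_zero {W : Set (Q'.atlas hd').Carrier} (hW : IsOpen W)
    (hWa : ∀ y ∈ W, (Q'.atlas hd').val y ∈ Q.O a) {g : (Q'.atlas hd').Carrier → ℂ}
    (hg : MDifferentiableOn 𝓘(ℂ, Fin d' → ℂ) 𝓘(ℂ, ℂ) g W) (hg0 : ∀ y ∈ W, h.lastEq hd' a y = 0 → g y = 0)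
    {y₀ : (Q'.atlas hd').Carrier} (hy₀ : y₀ ∈ W) (h0 : h.lastEq hd' a y₀ = 0) :
    ∃ V : Set (Q'.atlas hd').Carrier, IsOpen V ∧ y₀ ∈ V ∧ V ⊆ W ∧ ∃ q : (Q'.atlas hd').Carrier → ℂ,
      MDifferentiableOn 𝓘(ℂ, Fin d' → ℂ) 𝓘(ℂ, ℂ) q V ∧ ∀ y ∈ V, g y = h.lastEq hd' a y * q y := by
  obtain ⟨σ, hyσ, -, hσ1⟩ := h.exists_chart_lastEq hd hd' a (hWa y₀ hy₀) h0
  set Sσ : Set (Q'.atlas hd').Carrier := (Q'.atlas hd').toSubtype ⁻¹' σ.source with hSσ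
  have hSσo : IsOpen Sσ := σ.open_source.preimage (Q'.atlas hd').continuous_toSubtype
  set V : Set (Q'.atlas hd').Carrier := W ∩ Sσ with hVdef
  have hVo : IsOpen V := hW.inter hSσo
  -- the flat picture
  set T : Set (ℂ × (Fin d → ℂ)) := σ.target ∩ σ.toOpenPartialHomeomorph.symm ⁻¹' ((Q'.atlas hd').ofSubtype ⁻¹' V) with hT
  have hTo : IsOpen T :=
    σ.toOpenPartialHomeomorph.symm.isOpen_inter_preimage (hVo.preimage (Q'.atlas hd').continuous_ofSubtype)
  set gt : ℂ × (Fin d → ℂ) → ℂ := fun w ↦ g ((Q'.atlas hd').ofSubtype (σ.toOpenPartialHomeomorph.symm w)) with hgt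
  have hsymm : MDifferentiableOn 𝓘(ℂ, ℂ × (Fin d → ℂ)) 𝓘(ℂ, Fin d' → ℂ)
      (fun w ↦ (Q'.atlas hd').ofSubtype (σ.toOpenPartialHomeomorph.symm w)) σ.target := (Q'.atlas hd').mdifferentiableOn_chart_symm σ
  have hgtd : DifferentiableOn ℂ gt T := by
    rw [← mdifferentiableOn_iff_differentiableOn]
    exact hg.comp (hsymm.mono inter_subset_left) fun w hw ↦ hw.2.1
  have hfst : DifferentiableOn ℂ (fun w : ℂ × (Fin d → ℂ) ↦ w.1) T := differentiable_fst.differentiableOn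
  have hdt : ∀ w ∈ T, w.1 = 0 → fderiv ℂ (fun w : ℂ × (Fin d → ℂ) ↦ w.1) w ≠ 0 := by
    intro w _ _ hzero
    rw [show (fun w : ℂ × (Fin d → ℂ) ↦ w.1) = Prod.fst from rfl, fderiv_fst] at hzero
    have h1 := congrArg (fun L : (ℂ × (Fin d → ℂ)) →L[ℂ] ℂ ↦ L (1, 0)) hzero
    simp at h1
  have hσu : ∀ w ∈ σ.target, h.lastEq hd' a ((Q'.atlas hd').ofSubtype (σ.toOpenPartialHomeomorph.symm w)) = w.1 := by
    intro w hw
    rw [← hσ1 _ (σ.map_target hw), σ.right_inv hw]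
  have hzero : ∀ w ∈ T, w.1 = 0 → gt w = 0 := by
    intro w hw hw1
    apply hg0 _ hw.2.1
    rw [hσu w hw.1, hw1]
  obtain ⟨qt, hqt, hgq⟩ := Literature.Analysis.Complex.SCV.exists_eq_smul_of_eqOn_zero hTo hfst hgtd hdt hzero
  -- back to the manifold
  have hσN : MDifferentiableOn 𝓘(ℂ, Fin d' → ℂ) 𝓘(ℂ, ℂ × (Fin d → ℂ))
      (fun y : (Q'.atlas hd').Carrier ↦ σ.toOpenPartialHomeomorph ((Q'.atlas hd').toSubtype y)) Sσ := (Q'.atlas hd').mdifferentiableOn_chart σ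
  have hmapsT : ∀ y ∈ V, σ.toOpenPartialHomeomorph ((Q'.atlas hd').toSubtype y) ∈ T := by
    intro y hy
    refine ⟨σ.map_source hy.2, ?_⟩
    change (Q'.atlas hd').ofSubtype (σ.toOpenPartialHomeomorph.symm (σ.toOpenPartialHomeomorph ((Q'.atlas hd').toSubtype y))) ∈ V
    rw [σ.left_inv (x := (Q'.atlas hd').toSubtype y) hy.2]
    exact hy
  refine ⟨V, hVo, ⟨hy₀, hyσ⟩, inter_subset_left, fun y ↦ qt (σ.toOpenPartialHomeomorph ((Q'.atlas hd').toSubtype y)),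
    ?_, fun y hy ↦ ?_⟩
  · have hqt' : MDifferentiableOn 𝓘(ℂ, ℂ × (Fin d → ℂ)) 𝓘(ℂ, ℂ) qt T :=
      mdifferentiableOn_iff_differentiableOn.2 hqt
    exact hqt'.comp (hσN.mono inter_subset_right) hmapsT
  · have h1 := hgq _ (hmapsT y hy)
    have h2 : gt (σ.toOpenPartialHomeomorph ((Q'.atlas hd').toSubtype y)) = g y := by
      change g ((Q'.atlas hd').ofSubtype (σ.toOpenPartialHomeomorph.symm (σ.toOpenPartialHomeomorph ((Q'.atlas hd').toSubtype y)))) = g y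
      rw [σ.left_inv (x := (Q'.atlas hd').toSubtype y) hy.2]
      rfl
    rw [h2, smul_eq_mul, hσ1 ((Q'.atlas hd').toSubtype y) hy.2] at h1
    exact h1

/-- **Local division away from the zeros of `u`**: `q = g / u`. [folklore] -/
theorem exists_local_quotient_of_ne_zero {W : Set (Q'.atlas hd').Carrier} (hW : IsOpen W)
    (hWa : ∀ y ∈ W, (Q'.atlas hd').val y ∈ Q.O a) {g : (Q'.atlas hd').Carrier → ℂ}
    (hg : MDifferentiableOn 𝓘(ℂ, Fin d' → ℂ) 𝓘(ℂ, ℂ) g W)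
    {y₀ : (Q'.atlas hd').Carrier} (hy₀ : y₀ ∈ W) (h0 : h.lastEq hd' a y₀ ≠ 0) :
    ∃ V : Set (Q'.atlas hd').Carrier, IsOpen V ∧ y₀ ∈ V ∧ V ⊆ W ∧ ∃ q : (Q'.atlas hd').Carrier → ℂ,
      MDifferentiableOn 𝓘(ℂ, Fin d' → ℂ) 𝓘(ℂ, ℂ) q V ∧ ∀ y ∈ V, g y = h.lastEq hd' a y * q y := by
  have hWsub : W ⊆ (Q'.atlas hd').val ⁻¹' Q.O a := fun y hy ↦ hWa y hy
  set V : Set (Q'.atlas hd').Carrier := W ∩ (h.lastEq hd' a) ⁻¹' {0}ᶜ with hVdef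
  have hVo : IsOpen V :=
    ((h.continuousOn_lastEq hd' a).mono hWsub).isOpen_inter_preimage hW isOpen_compl_singleton
  have hinv : MDifferentiableOn 𝓘(ℂ, Fin d' → ℂ) 𝓘(ℂ, ℂ) (fun y ↦ (h.lastEq hd' a y)⁻¹) V := by
    have h1 : MDifferentiableOn 𝓘(ℂ, ℂ) 𝓘(ℂ, ℂ) (fun x : ℂ ↦ x⁻¹) {x | x ≠ 0} :=
      mdifferentiableOn_iff_differentiableOn.2 differentiableOn_inv
    exact h1.comp ((h.mdifferentiableOn_lastEq hd' a).mono fun y hy ↦ hWsub hy.1) fun y hy ↦ hy.2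
  refine ⟨V, hVo, ⟨hy₀, h0⟩, inter_subset_left, fun y ↦ g y * (h.lastEq hd' a y)⁻¹, ?_, fun y hy ↦ ?_⟩
  · exact (hg.mono inter_subset_left).mul hinv
  · have hne : h.lastEq hd' a y ≠ 0 := hy.2
    field_simp

include hd in
/-- **Division by the next equation on the bigger locus.** Let `W` be an open subset of the manifold
`Z' = Q'.locus` lying over `O_a` and `g` holomorphic on `W`, vanishing at the points of `W` over
`Z = Q.locus`. Then `g = u · q` on `W` for some `q` holomorphic on `W`, `u = (F_a)_{k'}` the last
equation (the local quotients of `exists_local_quotient_of_eq_zero` / `…_of_ne_zero` agree by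
`eq_of_lastEq_mul_eq` and glue). [cite: Chirka1989, §2.8] [cite: SerreGAGA1956, n° 16 Lemme 8] -/
theorem exists_eq_lastEq_mul {W : Set (Q'.atlas hd').Carrier} (hW : IsOpen W)
    (hWa : ∀ y ∈ W, (Q'.atlas hd').val y ∈ Q.O a) {g : (Q'.atlas hd').Carrier → ℂ}
    (hg : MDifferentiableOn 𝓘(ℂ, Fin d' → ℂ) 𝓘(ℂ, ℂ) g W)
    (hg0 : ∀ y ∈ W, (Q'.atlas hd').val y ∈ Q.locus → g y = 0) :
    ∃ q : (Q'.atlas hd').Carrier → ℂ, MDifferentiableOn 𝓘(ℂ, Fin d' → ℂ) 𝓘(ℂ, ℂ) q W ∧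
      ∀ y ∈ W, g y = h.lastEq hd' a y * q y := by
  have hg0' : ∀ y ∈ W, h.lastEq hd' a y = 0 → g y = 0 := fun y hy hy0 ↦
    hg0 y hy ((h.lastEq_eq_zero_iff hd' a (hWa y hy)).1 hy0)
  -- local quotients everywhere
  have hloc : ∀ y₀ ∈ W, ∃ V : Set (Q'.atlas hd').Carrier, IsOpen V ∧ y₀ ∈ V ∧ V ⊆ W ∧
      ∃ q : (Q'.atlas hd').Carrier → ℂ, MDifferentiableOn 𝓘(ℂ, Fin d' → ℂ) 𝓘(ℂ, ℂ) q V ∧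
        ∀ y ∈ V, g y = h.lastEq hd' a y * q y := by
    intro y₀ hy₀
    by_cases h0 : h.lastEq hd' a y₀ = 0
    · exact h.exists_local_quotient_of_eq_zero hd hd' a hW hWa hg hg0' hy₀ h0
    · exact h.exists_local_quotient_of_ne_zero hd' a hW hWa hg hy₀ h0
  choose! V hVo hyV hVW q hq hgq using hloc
  -- the local quotients agree where both are defined
  have hagree : ∀ y₀ ∈ W, ∀ y ∈ V y₀, q y y = q y₀ y := by
    intro y₀ hy₀ y hy
    have hyW : y ∈ W := hVW y₀ hy₀ hy
    have hcl := h.mem_closure_lastEq_ne_zero hd hd' a (hWa y hyW)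
    have hN : V y ∩ V y₀ ∈ 𝓝 y := inter_mem ((hVo y hyW).mem_nhds (hyV y hyW)) ((hVo y₀ hy₀).mem_nhds hy)
    refine h.eq_of_lastEq_mul_eq hd' a hcl hN ?_ ?_ fun y' hy' ↦ ?_
    · exact ((hq y hyW).continuousOn.continuousAt ((hVo y hyW).mem_nhds (hyV y hyW)))
    · exact ((hq y₀ hy₀).continuousOn.continuousAt ((hVo y₀ hy₀).mem_nhds hy))
    · rw [← hgq y hyW y' hy'.1, ← hgq y₀ hy₀ y' hy'.2]
  refine ⟨fun y ↦ q y y, fun y₀ hy₀ ↦ ?_, fun y hy ↦ hgq y hy y (hyV y hy)⟩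
  have hev : (fun y ↦ q y y) =ᶠ[𝓝 y₀] q y₀ :=
    eventuallyEq_of_mem ((hVo y₀ hy₀).mem_nhds (hyV y₀ hy₀)) fun y hy ↦ hagree y₀ hy₀ y hy
  have hdiff : MDifferentiableAt 𝓘(ℂ, Fin d' → ℂ) 𝓘(ℂ, ℂ) (q y₀) y₀ :=
    (hq y₀ hy₀ y₀ (hyV y₀ hy₀)).mdifferentiableAt ((hVo y₀ hy₀).mem_nhds (hyV y₀ hy₀))
  exact (hdiff.congr_of_eventuallyEq hev).mdifferentiableWithinAt

end IsPrefix

end RegularEquations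

end Literature.Geometry.Kaehler
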